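import Summits.Ventures.GridStability.Bench.SMIBDeg6AK13postD10Roa
import Summits.Ventures.GridStability.Bench.SMIBDeg4AK13postD10Roa
import Summits.Ventures.GridStability.Models.SMIBInstances
import HarnessLib

/-!
# G1.SMIB+ «SMIB deg-6»-roa (model half) — no pole slip and return to synchronism FOR model-1's classical SMIB model, from the
# DEGREE-6 certificate: parametric SMIB reading and the typed instance of record `SMIB.K13postD10` (hypothesis-free)

Venture GRIDFUSION, PARTITION A2/A5/A6, director RULING 12; seat gridfusion-lyap-2 (g4), generator `gen_smib6.py`. Sibling of
`SMIBDeg6AK13postD10Roa.lean` (recast half: `deg6_A_K13postD10_roa`, level `17/7`, arc `κ ≤ 1`), which it imports, and BRIDGE on lyap-1's deg-4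
companion `Bench/SMIBDeg4AK13postD10Roa.lean` (pattern of #62 / #50 `…RoaModel`): the deg-6 certificate rides on the SAME recast field (both =
model-1's `SMIB.polyField a b d` at SMIB-K13post-D10 verbatim; `gen_smib6.py` read-back: the deg-6 `…_f_<var>_poly` / `…_h_poly`
literals equal the deg-4 A file's `model.f / h` term for term) and the SAME embedding `SMIB.embed δs (δ, ω) = (sin u, 1 − cos u, ω)`,
so model-1's exact chain rule as packaged by lyap-1 (`deg4_A_K13postD10_hasDerivWithinAt_embed`, `deg4_A_K13postD10_embed_mem_M`) is imported, not redone: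
`deg6_A_K13postD10_F_eq_F`, `deg6_A_K13postD10_M_eq_M`. The instance reading uses model-1's kernel facts `SMIB.K13postD10_relations` / `K13postD10_isEquilibrium`
(`Models/SMIBInstances.lean`), so NO data hypothesis remains there.

THREE COLUMNS. CERTIFIED: the deg-6 Bench identities (consumed through `deg6_A_K13postD10_roa`). MODELLED: the classical SMIB model `M_smib`
of Anderson–Fouad (2.40)–(2.42) (+ damping, Sauer–Pai (5.157)) as typed by model-1 (`SMIB.field`, `SMIB.IsSolutionOn`), for ANY
parameter record `p` and equilibrium angle `δs` with the A1′ data relations of the instance (`a = 532761715096/15538499375`,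
`b = 4303847457/88791425`, `d = 10/7`), resp. the typed record `SMIB.K13postD10` (`M = 7/377`, `D = 10/377`, `P_m′ = 79912287/88791425`;
Kundur 1994 Ex. 13.1 post-fault plant with `K_D = 10` from Ex. 12.2 (iii) — a MODELLED choice; MODEL-VALIDITY MV-1). VALIDATED: nothing.
No sentence here says a machine or a grid is stable; «region of attraction» = the stated set of initial conditions OF THE MODEL is
carried to the model's synchronous equilibrium.

STATEMENTS. `deg6_A_K13postD10_smib_roa`: for every `0 < γ ≤ 17/7` and every solution `x = (δ, ω)` of `p` on `[0, ∞)` with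
`V₆(sin u₀, 1 − cos u₀, ω₀) ≤ γ` and `|u₀| < π` (`u = δ − δs`): `V₆ ≤ γ` along the recast state and `|u t| < π` for all `t ≥ 0` (no pole
slip), and `(δ t, ω t) → (δs, 0)`. `deg6_A_K13postD10_K13postD10_roa`: the same read on `SMIB.K13postD10` (`δs = SMIB.deltaK13`), hypothesis-free.
-/

namespace Summit.Ventures.GridStability.Bench.SMIB

open Set Filter Metric Topology Real
open Summit.Ventures.GridStability.Lyapunov Summit.Ventures.GridStability.Models
open Literature.Computation.Certificates Literature.Computation.Certificates.SOS

noncomputable section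

/-! ### The deg-6 certificate rides on the SAME recast field / constraint / embedding as the deg-4 companion -/

/-- The two Bench certificates of the instance carry the SAME recast field (both = model-1's `SMIB.polyField a b d` verbatim):
`deg6_A_K13postD10_F = deg4_A_K13postD10_F`. [folklore] -/
theorem deg6_A_K13postD10_F_eq_F : deg6_A_K13postD10_F = deg4_A_K13postD10_F := by
  funext z i
  fin_cases i <;>
    simp [deg6_A_K13postD10_F, deg4_A_K13postD10_F, deg6_A_K13postD10_f_sigma_eq, deg6_A_K13postD10_f_kappa_eq, deg6_A_K13postD10_f_omega_eq,
      deg4_A_K13postD10_f_sigma, deg4_A_K13postD10_f_kappa, deg4_A_K13postD10_f_omega]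

/-- … and the SAME constraint set `{h = 0}`: `deg6_A_K13postD10_M = deg4_A_K13postD10_M`. [folklore] -/
theorem deg6_A_K13postD10_M_eq_M : deg6_A_K13postD10_M = deg4_A_K13postD10_M := by
  ext z
  simp only [deg6_A_K13postD10_M, deg4_A_K13postD10_M, mem_setOf_eq, deg6_A_K13postD10_h_eq, deg4_A_K13postD10_h]

/-- The image of model-1's embedding `SMIB.embed δs` lies on THIS file's constraint set. [folklore] -/
theorem deg6_A_K13postD10_embed_mem_M (δs : ℝ) (y : ℝ × ℝ) :
    (fun i : Fin 3 ↦ SMIB.embed δs y i) ∈ deg6_A_K13postD10_M := by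
  rw [deg6_A_K13postD10_M_eq_M]
  exact deg4_A_K13postD10_embed_mem_M δs y

/-- **Exact embedding** for THIS Bench field, from the deg-4 companion's `deg4_A_K13postD10_hasDerivWithinAt_embed` and `…_F_eq_F`: along a
solution of the SMIB model `p` with the A1′ data relations of the instance, `t ↦ (sin u, 1 − cos u, ω)` solves `ż = F(z)`. [folklore] -/
theorem deg6_A_K13postD10_hasDerivWithinAt_embed (p : SMIB) {δs : ℝ} (hM : p.M ≠ 0)
    (ha : ((532761715096/15538499375 : ℚ) : ℝ) = p.PM * cos (δs - p.γ) / p.M)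
    (hb : ((4303847457/88791425 : ℚ) : ℝ) = p.PM * sin (δs - p.γ) / p.M)
    (hd : ((10/7 : ℚ) : ℝ) = p.D / p.M) (hP : p.IsEquilibrium δs)
    {x : ℝ → ℝ × ℝ} {s : Set ℝ} (hx : p.IsSolutionOn x s) {t : ℝ} (ht : t ∈ s) :
    HasDerivWithinAt (fun τ ↦ fun i : Fin 3 ↦ SMIB.embed δs (x τ) i)
      (deg6_A_K13postD10_F (fun i : Fin 3 ↦ SMIB.embed δs (x t) i)) s t := by
  rw [deg6_A_K13postD10_F_eq_F]
  exact deg4_A_K13postD10_hasDerivWithinAt_embed p hM ha hb hd hP hx ht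

/-! ### The ROA sentence in machine coordinates -/

/-- **G1.SMIB+ «SMIB deg-6»-roa in original coordinates, with angle recovery (A6).** For ANY SMIB record `p` and equilibrium angle
`δs` with the A1′ data relations of SMIB-K13post-D10 and `P_e(δs) = P_m`, every `0 < γ ≤ 17/7` and every solution `x = (δ, ω)` on
`[0, ∞)` with `V₆(sin u₀, 1 − cos u₀, ω₀) ≤ γ` and `|u₀| < π`: for all `t ≥ 0`, `V₆ ≤ γ` along the recast state and `|u t| < π` (no
pole slip), and `(δ t, ω t) → (δs, 0)`. See the module docstring for the three columns. [folklore] -/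
theorem deg6_A_K13postD10_smib_roa (p : SMIB) {δs : ℝ} (hM : p.M ≠ 0)
    (ha : ((532761715096/15538499375 : ℚ) : ℝ) = p.PM * cos (δs - p.γ) / p.M)
    (hb : ((4303847457/88791425 : ℚ) : ℝ) = p.PM * sin (δs - p.γ) / p.M)
    (hd : ((10/7 : ℚ) : ℝ) = p.D / p.M) (hP : p.IsEquilibrium δs)
    {γ : ℝ} (hγ0 : 0 < γ) (hγ : γ ≤ deg6_A_K13postD10_level) {x : ℝ → ℝ × ℝ} (hx : p.IsSolutionOn x (Ici 0))
    (h0V : deg6_A_K13postD10_V (sin ((x 0).1 - δs)) (1 - cos ((x 0).1 - δs)) (x 0).2 ≤ γ)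
    (h0win : |(x 0).1 - δs| < π) :
    (∀ t, 0 ≤ t → deg6_A_K13postD10_V (sin ((x t).1 - δs)) (1 - cos ((x t).1 - δs)) (x t).2 ≤ γ ∧
      |(x t).1 - δs| < π) ∧ Tendsto x atTop (𝓝 (δs, 0)) := by
  set z : ℝ → Fin 3 → ℝ := fun τ i ↦ SMIB.embed δs (x τ) i with hzdef
  have hxc : ContinuousOn x (Ici 0) := fun t ht ↦ (hx t ht).continuousWithinAt
  have hzc : ContinuousOn z (Ici 0) := by
    have hc : Continuous fun y : ℝ × ℝ ↦ fun i : Fin 3 ↦ SMIB.embed δs y i := by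
      refine continuous_pi fun i ↦ ?_
      fin_cases i <;> simp [SMIB.embed] <;> fun_prop
    exact hc.comp_continuousOn hxc
  have hz : ∀ t, 0 ≤ t → HasDerivWithinAt z (deg6_A_K13postD10_F (z t)) (Ici t) t := fun t ht ↦
    (deg6_A_K13postD10_hasDerivWithinAt_embed p hM ha hb hd hP hx ht).mono (Ici_subset_Ici.2 ht)
  have h0M : z 0 ∈ deg6_A_K13postD10_M := deg6_A_K13postD10_embed_mem_M δs (x 0)
  have h0V' : deg6_A_K13postD10_Vz (z 0) ≤ γ := by simpa [hzdef, deg6_A_K13postD10_Vz] using h0V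
  obtain ⟨hinv, hlim⟩ := deg6_A_K13postD10_roa hγ0 hγ hzc hz h0M h0V'
  have hV : ∀ t, 0 ≤ t → deg6_A_K13postD10_V (sin ((x t).1 - δs)) (1 - cos ((x t).1 - δs)) (x t).2 ≤ γ :=
    fun t ht ↦ by simpa [hzdef, deg6_A_K13postD10_Vz] using (hinv t ht).1
  -- no pole slip: `κ ≤ 1` on the certified piece gives `cos u ≥ 0 > -1`
  have hcos : ∀ t, 0 ≤ t → -1 < cos ((x t).1 - δs) := by
    intro t ht
    have hk := (hinv t ht).2
    simp only [hzdef, Fin.val_one, SMIB.embed_one] at hk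
    linarith
  have huc : ContinuousOn (fun t ↦ (x t).1 - δs) (Ici 0) :=
    (continuous_fst.comp_continuousOn hxc).sub continuousOn_const
  have hwin := abs_lt_pi_of_neg_one_lt_cos huc h0win hcos
  have hκ : Tendsto (fun t ↦ 1 - cos ((x t).1 - δs)) atTop (𝓝 0) := by
    simpa [hzdef] using tendsto_pi_nhds.1 hlim 1
  have hω : Tendsto (fun t ↦ (x t).2) atTop (𝓝 0) := by
    simpa [hzdef] using tendsto_pi_nhds.1 hlim 2
  have hu : Tendsto (fun t ↦ (x t).1 - δs) atTop (𝓝 0) :=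
    tendsto_zero_of_one_sub_cos_tendsto hwin hκ
  have hδ : Tendsto (fun t ↦ (x t).1) atTop (𝓝 δs) := by
    have h := hu.add_const δs
    simpa using h
  refine ⟨fun t ht ↦ ⟨hV t ht, hwin t ht⟩, ?_⟩
  have h := hδ.prodMk_nhds hω
  simpa using h

/-- **G1.SMIB+ «SMIB deg-6»-roa on the typed instance of record `SMIB.K13postD10`** (`δs = SMIB.deltaK13`; the data relations are
model-1's kernel facts `SMIB.K13postD10_relations` / `K13postD10_isEquilibrium`, NO data hypothesis left): every solution on `[0, ∞)`
with `V₆(sin u₀, 1 − cos u₀, ω₀) ≤ γ ≤ 17/7` and `|u₀| < π` keeps `V₆ ≤ γ`, never pole-slips and tends to `(δ*, 0)`. MODELLED: MV-1.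
[folklore] -/
theorem deg6_A_K13postD10_K13postD10_roa {γ : ℝ} (hγ0 : 0 < γ) (hγ : γ ≤ deg6_A_K13postD10_level)
    {x : ℝ → ℝ × ℝ} (hx : SMIB.K13postD10.IsSolutionOn x (Ici 0))
    (h0V : deg6_A_K13postD10_V (sin ((x 0).1 - SMIB.deltaK13)) (1 - cos ((x 0).1 - SMIB.deltaK13)) (x 0).2 ≤ γ)
    (h0win : |(x 0).1 - SMIB.deltaK13| < π) :
    (∀ t, 0 ≤ t → deg6_A_K13postD10_V (sin ((x t).1 - SMIB.deltaK13)) (1 - cos ((x t).1 - SMIB.deltaK13)) (x t).2 ≤ γ ∧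
      |(x t).1 - SMIB.deltaK13| < π) ∧ Tendsto x atTop (𝓝 (SMIB.deltaK13, 0)) := by
  obtain ⟨ha, hb, hd⟩ := SMIB.K13postD10_relations
  have hM : SMIB.K13postD10.M ≠ 0 := by simp only [SMIB.K13postD10]; norm_num
  exact deg6_A_K13postD10_smib_roa SMIB.K13postD10 hM ha hb hd SMIB.K13postD10_isEquilibrium hγ0 hγ hx h0V h0win

end

end Summit.Ventures.GridStability.Bench.SMIB
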